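import Summits.AtomisticToContinuum.Crystallization.Theorems.FreeSplittingCertificatesStrictSplittingRuleCoarseGapLadder
import Summits.AtomisticToContinuum.Crystallization.Theorems.OnePercentCertificate.Negative.TwoConeSABound
import Summits.AtomisticToContinuum.Crystallization.Theorems.FreeSplittingCertificatesStrictSplittingRulePerturbativeReduction

/-!
# `FiniteRangeSplitting` (stmt-AtomisticToContinuum-12559): the radius ladder `RungAt δ R`

Support file for crux r2 of route `FreeSplittingCertificates` (block-2b units `b2b-freesplit-A`, gens 2–4).
VALUE = theorems about what the R = 2 recurrent-pattern LP certificates decide — NOT summit progress.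
In the vocabulary of `StrictSplittingRuleBirth` (`IsRule`, `Sep`, `siteE`, `Feasible`, `eInf`):

* `RungAt δ R` — the rung `S_R(δ)`: some pair-splitting rule read at radius `R` is feasible on all finite
  `δ`-separated configurations; `finiteRangeSplitting_iff_rung : FiniteRangeSplitting ↔ ∀ δ > 0, ∃ R > 0, RungAt δ R`.
* `rungAt_mono_radius`, `rungAt_mono_sep` — the rungs form a ladder (truncate the pattern; a rule for `δ`
  serves every `δ' ≥ δ`): an LP refutation at `(δ, R)` refutes every `(δ', R')` with `δ' ≤ δ`, `R' ≤ R`.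
* `not_rungAt_of_zoo` — SOUNDNESS of the LP falsifier (a finite zoo of `δ`-separated configurations on whose
  site rows no rule reaches `eInf` refutes the rung); `rungAt_iff_finitelyFeasible` — COMPLETENESS for
  refutations (Tychonoff on the rule space `[0,1]^(E3 × Finset E3)`): `¬ RungAt δ R` is always witnessed by a
  finite zoo, and the LP falsifier can never PROVE a rung (`exists_zoo_of_not_rungAt`).
* `twoConeB_le_eInf : B ≤ eInf` with `B = -98309653/125000000` the tree's two-cone stability bound
  (`TwoConeSA.twoConeS_groundStateEnergy_ge`) pushed through the `⨅` of `eInf`.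
* INVERSION AVERAGING `invAvg Φ (v,T) = (Φ(v,T) + Φ(-v,-T))/2` is again a rule and is feasible when `Φ` is
  (`feasible_invAvg`); with complementarity it is MIDPOINT-ODD (`invAvg_eq_half`: weight exactly `1/2` on every
  bond whose joint pattern is symmetric about the bond midpoint).  Hence STAR FORCING
  (`eInf_le_half_sum_of_symmetric`): if `RungAt δ R` holds, then at every site of every `δ`-separated configuration
  all of whose bond patterns are midpoint-symmetric, `eInf ≤ ½ Σ_j V(r_ij)` — the soundness theorem behind the
  lane's star certificates (lj-lp VERDICT V2/V8).  The refuted rungs (instances) are in the companion files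
  `…RadiusLadderStar21` (`δ ≤ 5/6`) and `…RadiusLadderStar959` (`δ ≤ 23/25`).
-/

noncomputable section
namespace Summit.AtomisticToContinuum.Crystallization.Theorems.StrictSplittingRuleBirth

open scoped BigOperators Classical Topology
open Literature.MathematicalPhysics.StatisticalMechanics

/-- Euclidean `3`-space. -/
local notation "E3" => EuclideanSpace ℝ (Fin 3)

/-! ## The rung and the ladder -/

/-- The rung `S_R(δ)`: a pair-splitting rule read at radius `R` feasible on every finite `δ`-separated
configuration. [folklore] -/
def RungAt (δ R : ℝ) : Prop := ∃ Φ : E3 → Finset E3 → ℝ, IsRule Φ ∧ Feasible δ R Φ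

/-- Crux r2 is "every hard core has a rung". -/
theorem finiteRangeSplitting_iff_rung :
    Summit.AtomisticToContinuum.Crystallization.Theses.FreeSplittingCertificates.FiniteRangeSplitting ↔
      ∀ δ : ℝ, 0 < δ → ∃ R : ℝ, 0 < R ∧ RungAt δ R := by
  rw [finiteRangeSplitting_iff]
  refine forall₂_congr fun δ _ => ⟨?_, ?_⟩
  · rintro ⟨R, Φ, hR, hrule, hfeas⟩
    exact ⟨R, hR, Φ, hrule, hfeas⟩
  · rintro ⟨R, hR, Φ, hrule, hfeas⟩
    exact ⟨R, Φ, hR, hrule, hfeas⟩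

/-- Truncation of a rule to radius `R`: read only the part of the pattern within `R` of either endpoint. -/
def truncate (R : ℝ) (Φ : E3 → Finset E3 → ℝ) : E3 → Finset E3 → ℝ :=
  fun v T => Φ v (T.filter fun u => ‖u‖ ≤ R ∨ ‖u - v‖ ≤ R)

/-- The truncated pattern of the reversed bond is the reversal of the truncated pattern. [folklore] -/
theorem truncate_pattern_swap (R : ℝ) (v : E3) (T : Finset E3) :
    ((T.image fun u => u - v).filter fun u => ‖u‖ ≤ R ∨ ‖u - -v‖ ≤ R) =
      (T.filter fun u => ‖u‖ ≤ R ∨ ‖u - v‖ ≤ R).image fun u => u - v := by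
  ext w
  simp only [Finset.mem_filter, Finset.mem_image, sub_neg_eq_add]
  constructor
  · rintro ⟨⟨u, huT, rfl⟩, hw⟩
    refine ⟨u, ⟨huT, ?_⟩, rfl⟩
    rw [sub_add_cancel] at hw
    exact hw.symm
  · rintro ⟨u, ⟨huT, hu⟩, rfl⟩
    refine ⟨⟨u, huT, rfl⟩, ?_⟩
    rw [sub_add_cancel]
    exact hu.symm

/-- Truncation preserves the rule axioms (range and complementarity). [folklore] -/
theorem isRule_truncate {R : ℝ} {Φ : E3 → Finset E3 → ℝ} (h : IsRule Φ) : IsRule (truncate R Φ) := by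
  refine ⟨fun v T => h.1 v _, fun v T hv => ?_⟩
  show Φ v _ + Φ (-v) _ = 1
  rw [truncate_pattern_swap]
  exact h.2 v _ hv

/-- Reading a truncated rule at a larger radius gives the same site energies. -/
theorem siteE_truncate {R R' : ℝ} (hRR' : R ≤ R') (Φ : E3 → Finset E3 → ℝ) {N : ℕ} (x : Fin N → E3)
    (i : Fin N) : siteE R' (truncate R Φ) x i = siteE R Φ x i := by
  unfold siteE truncate
  refine Finset.sum_congr rfl fun j _ => ?_
  congr 2
  ext w
  simp only [Finset.mem_filter, Finset.mem_image, Finset.mem_univ, true_and]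
  constructor
  · rintro ⟨⟨l, _, rfl⟩, hw⟩
    refine ⟨l, ?_, rfl⟩
    rwa [dist_eq_norm, dist_eq_norm, show x l - x j = x l - x i - (x j - x i) by abel]
  · rintro ⟨l, hl, rfl⟩
    rw [dist_eq_norm, dist_eq_norm, show x l - x j = x l - x i - (x j - x i) by abel] at hl
    refine ⟨⟨l, ?_, rfl⟩, hl⟩
    rw [dist_eq_norm, dist_eq_norm, show x l - x j = x l - x i - (x j - x i) by abel]
    exact hl.imp (fun h1 => h1.trans hRR') (fun h2 => h2.trans hRR')

/-- A rule feasible at radius `R` is, truncated, feasible at every `R' ≥ R`. [folklore] -/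
theorem feasible_truncate {δ R R' : ℝ} (hRR' : R ≤ R') {Φ : E3 → Finset E3 → ℝ} (hf : Feasible δ R Φ) :
    Feasible δ R' (truncate R Φ) := by
  intro N x hx i
  rw [siteE_truncate hRR']
  exact hf N x hx i

/-- **The ladder in the radius**: a rung at radius `R` gives the rung at every larger radius. -/
theorem rungAt_mono_radius {δ R R' : ℝ} (hRR' : R ≤ R') : RungAt δ R → RungAt δ R' := by
  rintro ⟨Φ, hr, hf⟩
  exact ⟨truncate R Φ, isRule_truncate hr, feasible_truncate hRR' hf⟩

/-- **The ladder in the hard core**: a rung for `δ` serves every larger `δ'`. -/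
theorem rungAt_mono_sep {δ δ' R : ℝ} (hδ : δ ≤ δ') : RungAt δ R → RungAt δ' R := by
  rintro ⟨Φ, hr, hf⟩
  exact ⟨Φ, hr, fun N x hx i => hf N x (fun a b hab => hδ.trans (hx a b hab)) i⟩

/-! ## Soundness of the LP falsifier -/

/-- **A refuting zoo refutes the rung**: if on a finite family of `δ`-separated configurations every rule has
a site row strictly below `e_∞`, there is no rung at `(δ, R)` (and, by the ladder, none at any `δ' ≤ δ`,
`R' ≤ R`). -/
theorem not_rungAt_of_zoo {δ R : ℝ} (Z : Finset (Σ N : ℕ, Fin N → E3)) (hsep : ∀ c ∈ Z, Sep δ c.2)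
    (hinf : ∀ Φ : E3 → Finset E3 → ℝ, IsRule Φ → ∃ c ∈ Z, ∃ i : Fin c.1, siteE R Φ c.2 i < eInf) :
    ¬ RungAt δ R := by
  rintro ⟨Φ, hr, hf⟩
  obtain ⟨c, hc, i, hi⟩ := hinf Φ hr
  exact (not_lt.mpr (hf c.1 c.2 (hsep c hc) i)) hi

/-! ## Completeness for refutations (Tychonoff) -/

/-- Site energy of an uncurried rule is continuous in the product topology. -/
theorem continuous_siteE_uncurry (R : ℝ) {N : ℕ} (x : Fin N → E3) (i : Fin N) :
    Continuous fun f : E3 × Finset E3 → ℝ => siteE R (fun v T => f (v, T)) x i := by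
  unfold siteE
  exact continuous_finsetSum _ fun j _ => (continuous_apply _).mul continuous_const

/-- **`RungAt δ R` iff every finite `δ`-separated zoo admits a feasible rule.**  (`→` is trivial; `←` is
Tychonoff: the rule space `[0,1]^(E3 × Finset E3)` is compact, complementarity and each site row are closed
conditions, and finitely many of them are simultaneously satisfiable by hypothesis.) -/
theorem rungAt_iff_finitelyFeasible (δ R : ℝ) :
    RungAt δ R ↔ ∀ Z : Finset (Σ N : ℕ, Fin N → E3), (∀ c ∈ Z, Sep δ c.2) →
      ∃ Φ : E3 → Finset E3 → ℝ, IsRule Φ ∧ ∀ c ∈ Z, ∀ i : Fin c.1, eInf ≤ siteE R Φ c.2 i := by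
  constructor
  · rintro ⟨Φ, hr, hf⟩ Z hZ
    exact ⟨Φ, hr, fun c hc i => hf c.1 c.2 (hZ c hc) i⟩
  · intro h
    -- index of the closed constraints: complementarity at (v, T), and the row of site i of a separated configuration
    let ι := (E3 × Finset E3) ⊕ (Σ c : {c : (Σ N : ℕ, Fin N → E3) // Sep δ c.2}, Fin c.1.1)
    let K : Set (E3 × Finset E3 → ℝ) := Set.pi Set.univ fun _ => Set.Icc 0 1
    let t : ι → Set (E3 × Finset E3 → ℝ) := fun k =>
      match k with
      | Sum.inl p => {f | p.1 ≠ 0 → f p + f (-p.1, p.2.image fun u => u - p.1) = 1}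
      | Sum.inr ⟨c, i⟩ => {f | eInf ≤ siteE R (fun v T => f (v, T)) c.1.2 i}
    have hK : IsCompact K := isCompact_univ_pi fun _ => isCompact_Icc
    have htc : ∀ k, IsClosed (t k) := by
      rintro (p | ⟨c, i⟩)
      · by_cases hp : p.1 = 0
        · have : t (Sum.inl p) = Set.univ := by
            ext f
            simp [t, hp]
          rw [this]
          exact isClosed_univ
        · have : t (Sum.inl p) = (fun f : E3 × Finset E3 → ℝ => f p + f (-p.1, p.2.image fun u => u - p.1)) ⁻¹' {1} := by
            ext f
            simp [t, hp]
          rw [this]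
          exact isClosed_singleton.preimage
            ((continuous_apply p).add (continuous_apply (-p.1, p.2.image fun u => u - p.1)))
      · exact isClosed_le continuous_const (continuous_siteE_uncurry R c.1.2 i)
    have hst : ∀ u : Finset ι, (K ∩ ⋂ k ∈ u, t k).Nonempty := by
      intro u
      -- the zoo of configurations mentioned by u
      let conf : ι → Finset (Σ N : ℕ, Fin N → E3) := fun k =>
        match k with
        | Sum.inl _ => ∅
        | Sum.inr ⟨c, _⟩ => {c.1}
      let Z := u.biUnion conf
      have hZ : ∀ c ∈ Z, Sep δ c.2 := by
        intro c hc
        simp only [Z, Finset.mem_biUnion] at hc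
        obtain ⟨k, -, hk⟩ := hc
        rcases k with p | ⟨c', i'⟩
        · simp [conf] at hk
        · simp only [conf, Finset.mem_singleton] at hk
          rw [hk]
          exact c'.2
      obtain ⟨Φ, hr, hf⟩ := h Z hZ
      refine ⟨fun p => Φ p.1 p.2, ?_, ?_⟩
      · exact Set.mem_univ_pi.mpr fun p => hr.1 p.1 p.2
      · simp only [Set.mem_iInter]
        intro k hk
        rcases k with p | ⟨c', i'⟩
        · show p.1 ≠ 0 → Φ p.1 p.2 + Φ (-p.1) (p.2.image fun u => u - p.1) = 1
          exact hr.2 p.1 p.2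
        · show eInf ≤ siteE R (fun v T => Φ v T) c'.1.2 i'
          have hc' : c'.1 ∈ Z := by
            simp only [Z, Finset.mem_biUnion]
            exact ⟨Sum.inr ⟨c', i'⟩, hk, by simp [conf]⟩
          exact hf c'.1 hc' i'
    obtain ⟨f, hfK, hft⟩ := hK.inter_iInter_nonempty t htc hst
    simp only [Set.mem_iInter] at hft
    refine ⟨fun v T => f (v, T), ⟨fun v T => ?_, fun v T hv => ?_⟩, fun N x hx i => ?_⟩
    · have := (Set.mem_univ_pi.mp hfK) (v, T)
      exact ⟨this.1, this.2⟩
    · exact hft (Sum.inl (v, T)) hv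
    · exact hft (Sum.inr ⟨⟨⟨N, x⟩, hx⟩, i⟩)

/-- **Every non-rung is finitely witnessed** (the LP falsifier is complete for refutations). -/
theorem exists_zoo_of_not_rungAt {δ R : ℝ} (h : ¬ RungAt δ R) :
    ∃ Z : Finset (Σ N : ℕ, Fin N → E3), (∀ c ∈ Z, Sep δ c.2) ∧
      ∀ Φ : E3 → Finset E3 → ℝ, IsRule Φ → ∃ c ∈ Z, ∃ i : Fin c.1, siteE R Φ c.2 i < eInf := by
  by_contra hZ
  refine h ((rungAt_iff_finitelyFeasible δ R).2 fun Z hsep => ?_)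
  by_contra hΦ
  refine hZ ⟨Z, hsep, fun Φ hr => ?_⟩
  by_contra hc
  refine hΦ ⟨Φ, hr, fun c hcZ i => ?_⟩
  by_contra hlt
  exact hc ⟨c, hcZ, i, not_le.mp hlt⟩


/-! ## The threshold is a theorem: `e_∞ ≥ B` (tree two-cone bound) -/

/-- The tree's two-cone stability constant `B = -98309653/125000000 = -0.786477224`
(`TwoConeSA.twoConeS_groundStateEnergy_ge : -(|B|·N) ≤ E(N)`). [folklore] -/
def twoConeB : ℝ := -(98309653 / 125000000)

/-- `B ≤ e_∞`: the per-particle stability bound pushed through Fekete's infimum. -/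
theorem twoConeB_le_eInf : twoConeB ≤ eInf := by
  unfold eInf twoConeB
  refine le_ciInf fun M => ?_
  have h := TwoConeSA.twoConeS_groundStateEnergy_ge (M + 1)
  have hpos : (0 : ℝ) < ((M + 1 : ℕ) : ℝ) := by positivity
  rw [le_div_iff₀ hpos]
  linarith

/-! ## Inversion averaging and star forcing -/

/-- Inversion average of a rule: `(Φ(v,T) + Φ(-v,-T))/2`. [folklore] -/
def invAvg (Φ : E3 → Finset E3 → ℝ) : E3 → Finset E3 → ℝ :=
  fun v T => (Φ v T + Φ (-v) (T.image fun u => -u)) / 2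

/-- Negating a pattern twice gives it back. [folklore] -/
theorem image_neg_neg (T : Finset E3) :
    (T.image fun u : E3 => -u).image (fun u : E3 => -u) = T := by
  rw [Finset.image_image]
  have : ((fun u : E3 => -u) ∘ fun u : E3 => -u) = id := by
    funext u
    simp
  rw [this, Finset.image_id]

/-- The inversion average of a rule is a rule. -/
theorem isRule_invAvg {Φ : E3 → Finset E3 → ℝ} (h : IsRule Φ) : IsRule (invAvg Φ) := by
  refine ⟨fun v T => ?_, fun v T hv => ?_⟩
  · obtain ⟨h1, h2⟩ := h.1 v T
    obtain ⟨h3, h4⟩ := h.1 (-v) (T.image fun u => -u)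
    unfold invAvg
    constructor <;> linarith
  · have hv' : -v ≠ 0 := neg_ne_zero.mpr hv
    have e1 := h.2 v T hv
    have e2 := h.2 (-v) (T.image fun u => -u) hv'
    have hT : ((T.image fun u => u - v).image fun u : E3 => -u) =
        (T.image fun u : E3 => -u).image fun u => u - -v := by
      rw [Finset.image_image, Finset.image_image]
      congr 1
      funext u
      simp only [Function.comp_apply]
      abel
    unfold invAvg
    simp only [neg_neg] at e2 ⊢
    rw [hT]
    linarith

/-- The inversion average is inversion-equivariant. -/
theorem invAvg_neg (Φ : E3 → Finset E3 → ℝ) (v : E3) (T : Finset E3) :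
    invAvg Φ (-v) (T.image fun u => -u) = invAvg Φ v T := by
  unfold invAvg
  rw [neg_neg, image_neg_neg]
  ring

/-- **Midpoint-oddness**: an inversion average gives weight exactly `1/2` to a bond `v ≠ 0` whose pattern is
symmetric about the bond midpoint (`T = v - T`). -/
theorem invAvg_eq_half {Φ : E3 → Finset E3 → ℝ} (h : IsRule Φ) {v : E3} (hv : v ≠ 0) {T : Finset E3}
    (hT : T.image (fun u => v - u) = T) : invAvg Φ v T = 1 / 2 := by
  have hc := (isRule_invAvg h).2 v T hv
  have hT' : T.image (fun u => u - v) = T.image fun u : E3 => -u := by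
    conv_lhs => rw [← hT]
    rw [Finset.image_image]
    congr 1
    funext u
    simp only [Function.comp_apply]
    abel
  rw [hT', invAvg_neg] at hc
  linarith

/-- The bond patterns of the negated configuration are the negated bond patterns. -/
theorem bondPattern_neg (R : ℝ) {N : ℕ} (x : Fin N → E3) (i j : Fin N) :
    bondPattern R (fun k => -x k) i j = (bondPattern R x i j).image fun u => -u := by
  unfold bondPattern
  rw [Finset.image_image]
  have hf : (Finset.univ.filter fun l => dist (-x l) (-x i) ≤ R ∨ dist (-x l) (-x j) ≤ R) =
      Finset.univ.filter fun l => dist (x l) (x i) ≤ R ∨ dist (x l) (x j) ≤ R := by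
    simp only [dist_neg_neg]
  rw [hf]
  congr 1
  funext l
  simp only [Function.comp_apply]
  abel

/-- Site energies of `Φ` on `-x` are those of `(v,T) ↦ Φ(-v,-T)` on `x`. [folklore] -/
theorem siteE_neg (R : ℝ) (Φ : E3 → Finset E3 → ℝ) {N : ℕ} (x : Fin N → E3) (i : Fin N) :
    siteE R Φ (fun k => -x k) i = ∑ j ∈ Finset.univ.erase i,
      Φ (-(x j - x i)) ((bondPattern R x i j).image fun u => -u) * lennardJones (dist (x i) (x j)) := by
  rw [perturbative_siteE_eq]
  refine Finset.sum_congr rfl fun j _ => ?_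
  rw [bondPattern_neg, dist_neg_neg]
  congr 2
  abel

/-- Site energies of the inversion average are averages of site energies on `x` and on `-x`. -/
theorem siteE_invAvg (R : ℝ) (Φ : E3 → Finset E3 → ℝ) {N : ℕ} (x : Fin N → E3) (i : Fin N) :
    siteE R (invAvg Φ) x i = (siteE R Φ x i + siteE R Φ (fun k => -x k) i) / 2 := by
  rw [siteE_neg, perturbative_siteE_eq, perturbative_siteE_eq, ← Finset.sum_add_distrib,
    Finset.sum_div]
  refine Finset.sum_congr rfl fun j _ => ?_
  unfold invAvg
  ring

/-- The negated configuration is separated when `x` is. [folklore] -/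
theorem sep_neg {δ : ℝ} {N : ℕ} {x : Fin N → E3} (hx : Sep δ x) : Sep δ (fun k => -x k) := by
  intro i j hij
  show δ ≤ dist (-x i) (-x j)
  rw [dist_neg_neg]
  exact hx i j hij

/-- **Inversion averaging is free**: a feasible rule has a feasible inversion average. -/
theorem feasible_invAvg {δ R : ℝ} {Φ : E3 → Finset E3 → ℝ} (hf : Feasible δ R Φ) :
    Feasible δ R (invAvg Φ) := by
  intro N x hx i
  rw [siteE_invAvg]
  have h1 := hf N x hx i
  have h2 := hf N (fun k => -x k) (sep_neg hx) i
  linarith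

/-- **Star forcing.**  If a rung exists at `(δ, R)` (`0 < δ`), then at every site `i` of every `δ`-separated
configuration all of whose bond patterns are midpoint-symmetric, `e_∞ ≤ ½ Σ_j V(r_ij)`. -/
theorem eInf_le_half_sum_of_symmetric {δ R : ℝ} (hδ : 0 < δ) (hrung : RungAt δ R) {N : ℕ}
    (x : Fin N → E3) (hx : Sep δ x) (i : Fin N)
    (hsym : ∀ j, j ≠ i → (bondPattern R x i j).image (fun u => (x j - x i) - u) = bondPattern R x i j) :
    eInf ≤ (∑ j ∈ Finset.univ.erase i, lennardJones (dist (x i) (x j))) / 2 := by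
  obtain ⟨Φ, hr, hf⟩ := hrung
  have h := feasible_invAvg hf N x hx i
  rw [perturbative_siteE_eq] at h
  have hterm : ∀ j ∈ Finset.univ.erase i,
      invAvg Φ (x j - x i) (bondPattern R x i j) * lennardJones (dist (x i) (x j)) =
        lennardJones (dist (x i) (x j)) / 2 := by
    intro j hj
    have hji : j ≠ i := Finset.ne_of_mem_erase hj
    have hv : x j - x i ≠ 0 := by
      intro h0
      have hd := hx j i hji
      rw [dist_eq_norm, h0, norm_zero] at hd
      linarith
    rw [invAvg_eq_half hr hv (hsym j hji)]
    ring
  rw [Finset.sum_congr rfl hterm, ← Finset.sum_div] at h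
  exact h

end Summit.AtomisticToContinuum.Crystallization.Theorems.StrictSplittingRuleBirth

end
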